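import Literature.Barriers.BirchSwinnertonDyer.RankNotSumOfLocalInvariantsProofs
import Mathlib.NumberTheory.NumberField.Cyclotomic.Galois
import Mathlib.NumberTheory.NumberField.InfinitePlace.Ramification
import Mathlib.FieldTheory.Galois.Abelian
import Mathlib.Tactic.NormNum.Prime
import HarnessLib

/-!
# Barrier (BirchSwinnertonDyer): the rank modulo `3` — the field `F₃` of Dokchitser–Dokchitser, constructed

Companion to `Literature/Barriers/BirchSwinnertonDyer/RankNotSumOfLocalInvariantsProofs.lean`, which
reduces Theorem 2 of T. Dokchitser–V. Dokchitser, *A note on the Mordell–Weil rank modulo `n`*,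
J. Number Theory 131 (2011) 1833–1839 (arXiv:0910.4588), to three named facts, one per witness field.
The `n = 3` fact `Literature.Barriers.BirchSwinnertonDyer.DokchitserDokchitser2011_rank_480a1_F3`
bundles two things the printed proof (p. 3 of the arXiv copy) asserts about
"`F₃` = the degree 9 subfield of `ℚ(ζ₁₃, ζ₁₀₃)`":

1. *field arithmetic* — "Because 13 and 103 are cubes modulo one another, and all other primes are
   unramified in `F₃`, every place of `ℚ` splits into 3 or 9 in `F₃`";
2. *a descent computation* — "2-descent shows that `rk E/F₃ = 1`" for `E = 480a1` ("e.g. using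
   Magma, over all minimal non-trivial subfields of `F_n`").

This file CONSTRUCTS `F₃` and PROVES item 1 (and everything else the fact says about the field),
so that the named fact is reduced to item 2 alone, now a statement about a concrete number field —
the equation `(curve480a1.baseChange F₃).mordellWeilRank = 1` — to which it is moreover EQUIVALENT
(`DokchitserDokchitser2011_rank_480a1_F3_iff_descent`):

| source (DokchitserDokchitser2011RankModN, proof of Thm. 2) | declaration | status |
|---|---|---|
| `ℚ(ζ₁₃, ζ₁₀₃) = ℚ(ζ₁₃₃₉)`, `Gal ≅ (ℤ/1339)ˣ` | `DokchitserDokchitser2011.Cyclotomic1339`, `….galEquiv` | definition (Mathlib `CyclotomicField`, `IsCyclotomicExtension.Rat.galEquivZMod`) |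
| "the degree 9 subfield" `F₃` | `DokchitserDokchitser2011.F₃` (fixed field of `{σ : σ¹³⁶ = 1}`), `F₃.finrank_eq` (`[F₃ : ℚ] = 9`), `F₃.eq_of_finrank_eq` (it is the ONLY degree-9 subfield) | definition + proved |
| `F₃/ℚ` Galois | `F₃.instIsGalois` | proved (abelian) |
| "13 and 103 are cubes modulo one another" | `(13 : ZMod 103) ^ 34 = 1`, `(103 : ZMod 13) ^ 2 = 1` inside `F₃.ramificationIdxIn_mul_inertiaDegIn_dvd_three` | proved (`decide`) |
| "all other primes are unramified in `F₃`", "every place of `ℚ` splits into 3 or 9 in `F₃`" | `F₃.ramificationIdxIn_mul_inertiaDegIn_dvd_three` (`e_p f_p ∣ 3`), `F₃.three_dvd_card_placesOver` (finite places), `F₃.card_infinitePlace` (`9` real places), `F₃.three_dvd_card_infinitePlacesOver` | proved |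
| "2-descent shows that `rk E/F₃ = 1`" (Magma) | the hypothesis `(curve480a1.baseChange F₃).mordellWeilRank = 1` of the theorems of the last section | NOT formalised (a computer `2`-descent); the debt is carried by the parent named fact `DokchitserDokchitser2011_rank_480a1_F3` |
| the `n = 3` witness of Thm. 2 | `DokchitserDokchitser2011_rank_480a1_F3_of_descent`, `…_iff_descent`, `not_isSumOfLocalInvariants_rankInvariant_zmod_three_of_descent` | proved from that hypothesis |

Split review (2026-08-15, D-0026). An earlier version of this file vendored item 2 as a separate
named fact `DokchitserDokchitser2011_descent_480a1_F3 : Prop := (curve480a1.baseChange F₃).mordellWeilRank = 1`,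
a decomposition child of `DokchitserDokchitser2011_rank_480a1_F3`. It had the same locator as its
parent, was the parent specialised at `F := F₃` — indeed equivalent to it, `…_iff_descent` — and is
not provable short of a verified `2`-descent of `480a1` over the four cyclic cubic subfields of `F₃`
(conductors `13`, `103`, `1339`, `1339`: explicit integral bases, class groups, `S`-units for
`S ∣ 30` and local images at the primes above `2`, none of which Lean has), so it was not a
legitimate split child and has been merged back: the statement survives verbatim as the explicit
hypothesis of the theorems of the last section, the parent carries the debt, and nothing proved was
removed. The source prints no finer statement than "2-descent shows that `rk E/F₃ = 1` […] over all
minimal non-trivial subfields" (no Selmer dimensions), so there is nothing smaller to vendor; the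
reduction to the four cubic subfields is `RankNotSumOfLocalInvariantsF3Cubic.lean`.

## The mathematics (as formalised)

`Gal(ℚ(ζ₁₃₃₉)/ℚ) ≅ (ℤ/1339)ˣ ≅ (ℤ/13)ˣ × (ℤ/103)ˣ ≅ C₁₂ × C₁₀₂` has a unique quotient of order `9`
(`≅ C₃ × C₃`); its kernel is the `3'`-part `H = {g : g¹³⁶ = 1}` (`|H| = 4 · 34 = 136`, counted through
the Chinese remainder theorem), and `F₃ := ℚ(ζ₁₃₃₉)^H` has degree `1224 / 136 = 9`; any subfield of
degree `9` has fixing group of order `136`, hence of exponent dividing `136`, hence equal to `H`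
(`F₃.eq_of_finrank_eq`). For a rational prime `p` let `e_p, f_p, g_p` be its ramification index,
residue degree and number of primes in `F₃` (`F₃/ℚ` Galois: `g_p e_p f_p = 9`, Neukirch I (8.2),
(9.1)), and `e'_p, f'_p` those in `ℚ(ζ₁₃₃₉)`, so `e_p ∣ e'_p`, `f_p ∣ f'_p` (towers). By the
decomposition law in cyclotomic fields (Neukirch I (10.3); Mathlib
`IsCyclotomicExtension.Rat.ramificationIdxIn_eq` / `inertiaDegIn_eq`): for `p ∤ 1339`, `e'_p = 1`
and `f'_p = ord(p mod 1339)` divides the exponent `204 = lcm(12, 102)` of `(ℤ/1339)ˣ`, so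
`f_p ∣ gcd(9, 204) = 3`; for `p = 13`, `e'_p = 12` and `f'_p = ord(13 mod 103) ∣ 34` as
`13³⁴ ≡ 1 (mod 103)` (13 is a cube mod 103), so `e_p ∣ 3`, `f_p = 1`; for `p = 103`, `e'_p = 102`
and `f'_p = ord(103 mod 13) = 2` (`103 ≡ -1`, a cube mod 13), so `e_p ∣ 3`, `f_p = 1`. In all
cases `e_p f_p ∣ 3`, whence `g_p ∈ {3, 9}`. At infinity, `F₃/ℚ` is Galois of odd degree, hence
unramified (Mathlib `IsUnramifiedAtInfinitePlaces_of_odd_finrank`), so `F₃` has `9` real places.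

## Design notes

* `Cyclotomic1339` is a `def` wrapper (not an `abbrev`) around Mathlib's `CyclotomicField 1339 ℚ`:
  on the wrapper the only `ℚ`-algebra structure is the canonical `DivisionRing.toRatAlgebra` (the
  one the named fact `…_rank_480a1_F3` refers to, through `NumberField`), and Mathlib's instance
  `CyclotomicField.isCyclotomicExtension` — stated for the (propositionally, here even
  definitionally, equal) splitting-field algebra structure — is re-registered on the wrapper once.
  No instance is declared on a Mathlib type. The same diamond on `↥F₃` (`IntermediateField.algebra'`
  versus `DivisionRing.toRatAlgebra`, equal by `Rat.algebra_rat_subsingleton`) is crossed in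
  `F₃.instIsGalois` / `F₃.instIsScalarTower` by restating Mathlib's instances.
* The two numerical inputs "13 and 103 are cubes modulo one another" enter as
  `(13 : ZMod 103) ^ 34 = 1` and `(103 : ZMod 13) ^ 2 = 1` (kernel `decide`), the group-theoretic
  input as `u ^ 204 = 1` for `u : (ZMod 1339)ˣ` (Fermat in both CRT components) and
  `#{u : u ^ 136 = 1} = 4 · 34` (kernel `decide` in `(ZMod 13)ˣ` and `(ZMod 103)ˣ`).
* What is NOT here: the rank computation `rk E(F₃) = 1` (a `2`-descent over the four cubic subfields
  of `F₃`; the Mordell–Weil theorem is the tree's `WeierstrassCurve.module_finite_point_holds`, but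
  no explicit descent over a number field other than `ℚ` exists in Lean), which enters only as the
  hypothesis `(curve480a1.baseChange F₃).mordellWeilRank = 1`; and the analogous constructions of
  `F₄`, `F₅`.

## References

* T. Dokchitser, V. Dokchitser, *A note on the Mordell–Weil rank modulo `n`*, J. Number Theory 131
  (2011) 1833–1839, arXiv:0910.4588: proof of Thm. 2 (p. 3 of the held arXiv copy).
  [DokchitserDokchitser2011RankModN]
* J. Neukirch, *Algebraic Number Theory*, Grundlehren 322 (1999): Ch. I (8.2) (fundamental identity
  `∑ eᵢ fᵢ = n`), (9.1) (transitivity of the Galois action, `n = e f g`), (10.3) (decomposition law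
  in `ℚ(ζₙ)`), (10.4). [NeukirchANT1999]
-/

noncomputable section

open scoped NumberField

open NumberField IsDedekindDomain WeierstrassCurve Ideal IsCyclotomicExtension

namespace Literature.Barriers.BirchSwinnertonDyer

namespace DokchitserDokchitser2011

/-! ### Arithmetic in `(ℤ/1339)ˣ ≅ (ℤ/13)ˣ × (ℤ/103)ˣ` -/

/-- The Chinese remainder isomorphism `(ℤ/1339)ˣ ≃ (ℤ/13)ˣ × (ℤ/103)ˣ` (`1339 = 13 · 103`; Mathlib
`ZMod.chineseRemainder`). [folklore] -/
def crtUnitsEquiv : (ZMod 1339)ˣ ≃* (ZMod 13)ˣ × (ZMod 103)ˣ :=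
  (Units.mapEquiv (ZMod.chineseRemainder (by norm_num : Nat.Coprime 13 103)).toMulEquiv).trans
    MulEquiv.prodUnits

/-- The `3'`-part of `(ℤ/1339)ˣ ≅ C₁₂ × C₁₀₂` has order `136`: `#{u : u¹³⁶ = 1} = 4 · 34`, counted
in the two CRT components (`u¹³⁶ = 1 ↔ u₁₃⁴ = 1 ∧ u₁₀₃³⁴ = 1`). [folklore] -/
theorem card_pow_eq_one_136 : Nat.card {u : (ZMod 1339)ˣ // u ^ 136 = 1} = 136 := by
  have h1 : Nat.card {u : (ZMod 13)ˣ // u ^ 136 = 1} = 4 := by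
    rw [Nat.card_eq_fintype_card]; decide +kernel
  have h2 : Nat.card {u : (ZMod 103)ˣ // u ^ 136 = 1} = 34 := by
    rw [Nat.card_eq_fintype_card]; decide +kernel
  have e : {u : (ZMod 1339)ˣ // u ^ 136 = 1} ≃
      {u : (ZMod 13)ˣ // u ^ 136 = 1} × {u : (ZMod 103)ˣ // u ^ 136 = 1} := by
    refine (Equiv.subtypeEquiv (q := fun v => v.1 ^ 136 = 1 ∧ v.2 ^ 136 = 1)
      crtUnitsEquiv.toEquiv (fun u => ?_)).trans (Equiv.subtypeProdEquivProd
        (p := fun a : (ZMod 13)ˣ => a ^ 136 = 1) (q := fun b : (ZMod 103)ˣ => b ^ 136 = 1))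
    change u ^ 136 = 1 ↔ (crtUnitsEquiv u).1 ^ 136 = 1 ∧ (crtUnitsEquiv u).2 ^ 136 = 1
    rw [← crtUnitsEquiv.injective.eq_iff, map_pow, map_one, Prod.ext_iff, Prod.pow_fst,
      Prod.pow_snd, Prod.fst_one, Prod.snd_one]
  rw [Nat.card_congr e, Nat.card_prod, h1, h2]

/-- The exponent of `(ℤ/1339)ˣ ≅ C₁₂ × C₁₀₂` divides `204 = lcm(12, 102)`: `u²⁰⁴ = 1` (Fermat's
little theorem in both CRT components). [folklore] -/
theorem units_pow_204 (u : (ZMod 1339)ˣ) : u ^ 204 = 1 := by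
  haveI : Fact (Nat.Prime 13) := ⟨by norm_num⟩
  haveI : Fact (Nat.Prime 103) := ⟨by norm_num⟩
  apply crtUnitsEquiv.injective
  rw [map_pow, map_one, Prod.ext_iff, Prod.pow_fst, Prod.pow_snd, Prod.fst_one, Prod.snd_one]
  refine ⟨?_, ?_⟩
  · have h : (crtUnitsEquiv u).1 ^ 12 = 1 := by
      simpa using ZMod.units_pow_card_sub_one_eq_one 13 (crtUnitsEquiv u).1
    rw [show (204 : ℕ) = 12 * 17 by norm_num, pow_mul, h, one_pow]
  · have h : (crtUnitsEquiv u).2 ^ 102 = 1 := by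
      simpa using ZMod.units_pow_card_sub_one_eq_one 103 (crtUnitsEquiv u).2
    rw [show (204 : ℕ) = 102 * 2 by norm_num, pow_mul, h, one_pow]

/-- For `p` prime to `1339`, the order of `p` modulo `1339` divides `204`. [folklore] -/
theorem orderOf_natCast_dvd_204 {p : ℕ} (hp : p.Coprime 1339) : orderOf (p : ZMod 1339) ∣ 204 := by
  rw [← ZMod.coe_unitOfCoprime p hp, orderOf_units]
  exact orderOf_dvd_of_pow_eq_one (units_pow_204 _)

/-- Arithmetic of the three cases: if `e ∣ A`, `f ∣ B`, `e f ∣ 9` and `gcd(A, 9) · gcd(B, 9) ∣ 3` then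
`e f ∣ 3`. [folklore] -/
theorem mul_dvd_three_of_dvd {e f A B : ℕ} (he : e ∣ A) (hf : f ∣ B) (h9 : e * f ∣ 9)
    (h : Nat.gcd A 9 * Nat.gcd B 9 ∣ 3) : e * f ∣ 3 :=
  (mul_dvd_mul (Nat.dvd_gcd he (dvd_of_mul_right_dvd h9))
    (Nat.dvd_gcd hf (dvd_of_mul_left_dvd h9))).trans h

/-! ### `ℚ(ζ₁₃₃₉) = ℚ(ζ₁₃, ζ₁₀₃)` -/

/-- **`ℚ(ζ₁₃₃₉) = ℚ(ζ₁₃, ζ₁₀₃)`**, Mathlib's `CyclotomicField 1339 ℚ` behind a `def` (so that its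
`ℚ`-algebra structure is the canonical `DivisionRing.toRatAlgebra`, see the design notes).
[cite: DokchitserDokchitser2011RankModN, proof of Thm. 2] -/
def Cyclotomic1339 : Type := CyclotomicField 1339 ℚ

namespace Cyclotomic1339

/-- `ℚ(ζ₁₃₃₉)` is a field (Mathlib). [folklore] -/
instance instField : Field Cyclotomic1339 := inferInstanceAs (Field (CyclotomicField 1339 ℚ))

/-- `ℚ(ζ₁₃₃₉)` is a number field (Mathlib). [folklore] -/
instance instNumberField : NumberField Cyclotomic1339 :=
  inferInstanceAs (NumberField (CyclotomicField 1339 ℚ))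

/-- `ℚ(ζ₁₃₃₉)` is a `1339`-th cyclotomic extension of `ℚ` for its canonical `ℚ`-algebra structure
(Mathlib `CyclotomicField.isCyclotomicExtension`, transported along the definitional equality of
the two `ℚ`-algebra structures). [folklore] -/
instance instIsCyclotomicExtension : IsCyclotomicExtension {1339} ℚ Cyclotomic1339 :=
  CyclotomicField.isCyclotomicExtension 1339 ℚ

/-- `ℚ(ζ₁₃₃₉)/ℚ` is an abelian (in particular Galois) extension (Mathlib
`IsCyclotomicExtension.isAbelianGalois`). [folklore] -/
instance instIsAbelianGalois : IsAbelianGalois ℚ Cyclotomic1339 :=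
  IsCyclotomicExtension.isAbelianGalois {1339} ℚ Cyclotomic1339

/-- `Gal(ℚ(ζ₁₃₃₉)/ℚ) ≅ (ℤ/1339)ˣ`, `σ ↦ a` with `σ ζ = ζᵃ` (Mathlib
`IsCyclotomicExtension.Rat.galEquivZMod`; Neukirch, Ch. I §10). [folklore] -/
abbrev galEquiv : Gal(Cyclotomic1339/ℚ) ≃* (ZMod 1339)ˣ :=
  IsCyclotomicExtension.Rat.galEquivZMod 1339 Cyclotomic1339

/-- `[ℚ(ζ₁₃₃₉) : ℚ] = φ(1339) = 12 · 102 = 1224`. [folklore] -/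
theorem finrank_eq : Module.finrank ℚ Cyclotomic1339 = 1224 := by
  rw [IsCyclotomicExtension.finrank (n := 1339) Cyclotomic1339
    (Polynomial.cyclotomic.irreducible_rat (by norm_num))]
  decide +kernel

/-- The identity `ℚ(ζ₁₃₃₉) → CyclotomicField 1339 ℚ` as a `ℚ`-algebra map (both sides carry the
canonical `ℚ`-algebra structure). [folklore] -/
def toCyclotomicField : Cyclotomic1339 →ₐ[ℚ] CyclotomicField 1339 ℚ where
  toRingHom := RingHom.id (CyclotomicField 1339 ℚ)
  commutes' _ := rfl

/-- The identity `CyclotomicField 1339 ℚ → ℚ(ζ₁₃₃₉)` as a `ℚ`-algebra map (inverse to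
`toCyclotomicField`; both sides carry the canonical `ℚ`-algebra structure). [folklore] -/
def ofCyclotomicField : CyclotomicField 1339 ℚ →ₐ[ℚ] Cyclotomic1339 where
  toRingHom := RingHom.id (CyclotomicField 1339 ℚ)
  commutes' _ := rfl

end Cyclotomic1339

open Cyclotomic1339

/-! ### The field `F₃` -/

/-- The subgroup `H = {σ : σ¹³⁶ = 1}` of `Gal(ℚ(ζ₁₃₃₉)/ℚ) ≅ (ℤ/1339)ˣ ≅ C₁₂ × C₁₀₂`: the elements
of order prime to `3` (`136 = 1224 / 9`), i.e. the kernel of the projection onto the largest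
quotient of exponent `3`, `C₃ × C₃`. Its fixed field is `F₃`. [folklore] -/
def F₃.subgroup : Subgroup Gal(Cyclotomic1339/ℚ) :=
  (MonoidHom.ker (powMonoidHom 136 : (ZMod 1339)ˣ →* (ZMod 1339)ˣ)).comap galEquiv.toMonoidHom

/-- **The field `F₃` of Dokchitser–Dokchitser**: "the degree 9 subfield of `ℚ(ζ₁₃, ζ₁₀₃)`",
realised as the fixed field in `ℚ(ζ₁₃₃₉)` of `H = {σ : σ¹³⁶ = 1}`; it has degree `9`
(`F₃.finrank_eq`) and is the unique subfield of degree `9` (`F₃.eq_of_finrank_eq`).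
(Mathematically `F₃` is the compositum of the cubic subfields of `ℚ(ζ₁₃)` and `ℚ(ζ₁₀₃)` and
`Gal(F₃/ℚ) ≅ C₃ × C₃`; neither description is formalised or used here.)
[cite: DokchitserDokchitser2011RankModN, proof of Thm. 2] -/
def F₃ : IntermediateField ℚ Cyclotomic1339 :=
  IntermediateField.fixedField F₃.subgroup

namespace F₃

/-- Membership in `H`: `σ ∈ H ↔ a_σ¹³⁶ = 1` in `(ℤ/1339)ˣ`. [folklore] -/
theorem mem_subgroup_iff (σ : Gal(Cyclotomic1339/ℚ)) : σ ∈ F₃.subgroup ↔ galEquiv σ ^ 136 = 1 := by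
  simp [F₃.subgroup]

/-- `|H| = 136`. [folklore] -/
theorem card_subgroup : Nat.card F₃.subgroup = 136 := by
  rw [← card_pow_eq_one_136]
  exact Nat.card_congr (Equiv.subtypeEquiv galEquiv.toEquiv fun σ => mem_subgroup_iff σ)

/-- `[ℚ(ζ₁₃₃₉) : F₃] = |H| = 136` (Artin). [folklore] -/
theorem finrank_cyclotomic1339 : Module.finrank F₃ Cyclotomic1339 = 136 := by
  rw [F₃, IntermediateField.finrank_fixedField_eq_card, card_subgroup]

/-- `F₃/ℚ` is Galois — every subextension of the abelian extension `ℚ(ζ₁₃₃₉)/ℚ` is (Mathlib's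
instance, restated for the canonical `ℚ`-algebra structure on `↥F₃`). [folklore] -/
instance instIsGalois : IsGalois ℚ F₃ := by
  have h : @IsGalois ℚ _ F₃ _ F₃.algebra' := inferInstance
  exact h

/-- `ℚ → F₃ → ℚ(ζ₁₃₃₉)` is a scalar tower (for the canonical `ℚ`-algebra structure on `↥F₃`).
[folklore] -/
instance instIsScalarTower : IsScalarTower ℚ F₃ Cyclotomic1339 := by
  have h : @IsScalarTower ℚ F₃ Cyclotomic1339 F₃.algebra'.toSMul inferInstance inferInstance :=
    inferInstance
  exact h

/-- **`[F₃ : ℚ] = 9`** ("the degree 9 subfield"): `1224 = [F₃ : ℚ] · 136`.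
[cite: DokchitserDokchitser2011RankModN, proof of Thm. 2] -/
theorem finrank_eq : Module.finrank ℚ F₃ = 9 := by
  have h := Module.finrank_mul_finrank ℚ F₃ Cyclotomic1339
  rw [finrank_cyclotomic1339, Cyclotomic1339.finrank_eq] at h
  omega

/-- `|Gal(F₃/ℚ)| = 9`. [folklore] -/
theorem card_aut : Nat.card Gal(F₃/ℚ) = 9 := by
  rw [IsGalois.card_aut_eq_finrank, finrank_eq]

/-- **`F₃` is THE degree-9 subfield of `ℚ(ζ₁₃₃₉)`**: a subfield of degree `9` has fixing group of
order `136`, whose elements therefore satisfy `σ¹³⁶ = 1`, so it lies in (hence equals) `H`.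
[cite: DokchitserDokchitser2011RankModN, proof of Thm. 2] -/
theorem eq_of_finrank_eq (E : IntermediateField ℚ Cyclotomic1339) (hE : Module.finrank ℚ E = 9) :
    E = F₃ := by
  haveI : IsScalarTower ℚ E Cyclotomic1339 := by
    have h : @IsScalarTower ℚ E Cyclotomic1339 E.algebra'.toSMul inferInstance inferInstance :=
      inferInstance
    exact h
  have hK : Nat.card E.fixingSubgroup = 136 := by
    rw [IsGalois.card_fixingSubgroup_eq_finrank]
    have h := Module.finrank_mul_finrank ℚ E Cyclotomic1339
    rw [hE, Cyclotomic1339.finrank_eq] at h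
    omega
  have hle : E.fixingSubgroup ≤ F₃.subgroup := by
    intro σ hσ
    rw [mem_subgroup_iff, ← map_pow, ← hK, ← Subgroup.coe_mk E.fixingSubgroup σ hσ,
      ← Subgroup.coe_pow, pow_card_eq_one', Subgroup.coe_one, map_one]
  rw [← IsGalois.fixedField_fixingSubgroup E,
    Subgroup.eq_of_le_of_card_ge hle (by rw [hK, card_subgroup]), F₃]

/-- The inclusion `F₃ ⊂ ℚ(ζ₁₃₃₉) = CyclotomicField 1339 ℚ` as a `ℚ`-algebra map (for the canonical
`ℚ`-algebra structures). [folklore] -/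
def toCyclotomicField : F₃ →ₐ[ℚ] CyclotomicField 1339 ℚ :=
  Cyclotomic1339.toCyclotomicField.comp
    { toRingHom := F₃.val.toRingHom, commutes' := fun r => F₃.val.commutes r }

/-! ### Splitting of primes in `F₃` -/

/-- **Every rational prime has `e_p f_p ∣ 3` in `F₃`.** With `e'_p, f'_p` the invariants of `p` in
`ℚ(ζ₁₃₃₉)` one has `e_p ∣ e'_p`, `f_p ∣ f'_p` (towers) and `e_p f_p ∣ 9 = [F₃ : ℚ]`; by the
decomposition law in `ℚ(ζ₁₃₃₉)` (Neukirch I (10.3)): `p ∤ 1339` gives `e'_p = 1`,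
`f'_p = ord(p mod 1339) ∣ 204`, so `e_p f_p ∣ 3` ("all other primes are unramified in `F₃`");
`p = 13` gives `e'_p = 12`, `f'_p = ord(13 mod 103) ∣ 34` since `13³⁴ ≡ 1 (mod 103)`; `p = 103`
gives `e'_p = 102`, `f'_p = ord(103 mod 13) ∣ 2` since `103 ≡ -1 (mod 13)` ("13 and 103 are
cubes modulo one another"); in both ramified cases `e_p ∣ 3` and `f_p = 1`.
[cite: DokchitserDokchitser2011RankModN, proof of Thm. 2] [cite: NeukirchANT1999, Ch. I (10.3)] -/
theorem ramificationIdxIn_mul_inertiaDegIn_dvd_three (p : ℕ) [hp : Fact p.Prime] :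
    (span {(p : ℤ)}).ramificationIdxIn (𝓞 F₃) * (span {(p : ℤ)}).inertiaDegIn (𝓞 F₃) ∣ 3 := by
  obtain ⟨P, _, _⟩ := exists_maximal_ideal_liesOver_of_isIntegral (span {(p : ℤ)}) (S := 𝓞 F₃)
  have he := ramificationIdxIn_mul_ramificationIdxIn (p := span {(p : ℤ)}) P Gal(F₃/ℚ)
    (𝓞 Cyclotomic1339) Gal(Cyclotomic1339/ℚ) Gal(Cyclotomic1339/F₃)
  have hf := inertiaDegIn_mul_inertiaDegIn (span {(p : ℤ)}) P Gal(F₃/ℚ) (𝓞 Cyclotomic1339)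
    Gal(Cyclotomic1339/ℚ) Gal(Cyclotomic1339/F₃)
  have h9 : (span {(p : ℤ)}).ramificationIdxIn (𝓞 F₃) * (span {(p : ℤ)}).inertiaDegIn (𝓞 F₃) ∣ 9 := by
    have h := ncard_primesOver_mul_ramificationIdxIn_mul_inertiaDegIn (span {(p : ℤ)}) (𝓞 F₃)
      Gal(F₃/ℚ)
    rw [card_aut] at h
    exact Dvd.intro_left _ h
  by_cases h13 : p = 13
  · subst h13
    have hn : (1339 : ℕ) = 13 ^ (0 + 1) * 103 := by norm_num
    have hm : ¬ (13 : ℕ) ∣ 103 := by norm_num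
    refine mul_dvd_three_of_dvd (A := 13 ^ 0 * (13 - 1)) (B := 34) ?_ ?_ h9 (by norm_num)
    · rw [← IsCyclotomicExtension.Rat.ramificationIdxIn_eq 1339 Cyclotomic1339 hn hm, ← he]
      exact dvd_mul_right _ _
    · refine (Dvd.intro _ hf).trans ?_
      rw [IsCyclotomicExtension.Rat.inertiaDegIn_eq 1339 Cyclotomic1339 hn hm]
      exact orderOf_dvd_of_pow_eq_one (by decide +kernel)
  by_cases h103 : p = 103
  · subst h103
    have hn : (1339 : ℕ) = 103 ^ (0 + 1) * 13 := by norm_num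
    have hm : ¬ (103 : ℕ) ∣ 13 := by norm_num
    refine mul_dvd_three_of_dvd (A := 103 ^ 0 * (103 - 1)) (B := 2) ?_ ?_ h9 (by norm_num)
    · rw [← IsCyclotomicExtension.Rat.ramificationIdxIn_eq 1339 Cyclotomic1339 hn hm, ← he]
      exact dvd_mul_right _ _
    · refine (Dvd.intro _ hf).trans ?_
      rw [IsCyclotomicExtension.Rat.inertiaDegIn_eq 1339 Cyclotomic1339 hn hm]
      exact orderOf_dvd_of_pow_eq_one (by decide +kernel)
  -- the unramified primes
  have hcop : p.Coprime 1339 := by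
    rw [show (1339 : ℕ) = 13 * 103 by norm_num, Nat.coprime_mul_iff_right,
      Nat.coprime_primes hp.out (by norm_num), Nat.coprime_primes hp.out (by norm_num)]
    exact ⟨h13, h103⟩
  have hm : ¬ p ∣ 1339 := (Nat.Prime.coprime_iff_not_dvd hp.out).mp hcop
  refine mul_dvd_three_of_dvd (A := 1) (B := 204) ?_ ?_ h9 (by norm_num)
  · rw [← IsCyclotomicExtension.Rat.ramificationIdxIn_eq_of_not_dvd p Cyclotomic1339 hm, ← he]
    exact dvd_mul_right _ _
  · refine (Dvd.intro _ hf).trans ?_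
    rw [IsCyclotomicExtension.Rat.inertiaDegIn_eq_of_not_dvd p Cyclotomic1339 hm]
    exact orderOf_natCast_dvd_204 hcop

/-- Ideals of `𝓞 ℚ` are determined by their contraction to `ℤ` (`ℤ → 𝓞 ℚ` is surjective, Mathlib
`Rat.ringOfIntegersEquiv`). [folklore] -/
theorem ideal_ringOfIntegers_rat_eq_of_under_eq {Q Q' : Ideal (𝓞 ℚ)} (h : Q.under ℤ = Q'.under ℤ) :
    Q = Q' := by
  have hsurj : Function.Surjective (algebraMap ℤ (𝓞 ℚ)) := by
    intro x
    refine ⟨Rat.ringOfIntegersEquiv x, ?_⟩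
    rw [RingHom.ext_int (algebraMap ℤ (𝓞 ℚ)) Rat.ringOfIntegersEquiv.symm.toRingHom]
    exact Rat.ringOfIntegersEquiv.symm_apply_apply x
  rw [← Ideal.map_comap_of_surjective _ hsurj Q, ← Ideal.map_comap_of_surjective _ hsurj Q']
  exact congrArg _ h

/-- The finite places of `F₃` above a finite place `v` of `ℚ` are the primes of `𝓞 F₃` over the
rational prime `(p) = v ∩ ℤ` (`p = N(v ∩ ℤ)`; Mathlib `Int.liesOver_span_absNorm`). [folklore] -/
theorem card_placesOver_eq_ncard_primesOver (v : HeightOneSpectrum (𝓞 ℚ))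
    [Fact (absNorm (v.asIdeal.under ℤ)).Prime] :
    Nat.card {w : HeightOneSpectrum (𝓞 F₃) // w.under (𝓞 ℚ) = v} =
      ((span {((absNorm (v.asIdeal.under ℤ) : ℕ) : ℤ)}).primesOver (𝓞 F₃)).ncard := by
  have hp0 : span {((absNorm (v.asIdeal.under ℤ) : ℕ) : ℤ)} ≠ ⊥ := by
    rw [Ne, Ideal.span_singleton_eq_bot]
    exact_mod_cast (Fact.out : (absNorm (v.asIdeal.under ℤ)).Prime).ne_zero
  rw [← Nat.card_coe_set_eq]
  refine Nat.card_congr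
    { toFun := fun w => ⟨w.1.asIdeal, w.1.isPrime, ?_⟩
      invFun := fun P => ⟨⟨P.1, P.2.1, Ideal.ne_bot_of_mem_primesOver hp0 P.2⟩, ?_⟩
      left_inv := fun w => by ext1; rfl
      right_inv := fun P => by rfl }
  · haveI : w.1.asIdeal.LiesOver v.asIdeal := ⟨(congrArg HeightOneSpectrum.asIdeal w.2).symm⟩
    exact Ideal.LiesOver.trans w.1.asIdeal v.asIdeal _
  · apply HeightOneSpectrum.ext
    simp only [HeightOneSpectrum.under_asIdeal]
    apply ideal_ringOfIntegers_rat_eq_of_under_eq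
    rw [Ideal.under_under, ← P.2.2.over]
    exact (Int.liesOver_span_absNorm v.asIdeal).over

/-- **Every finite place of `ℚ` has `3` or `9` places of `F₃` above it**; in particular their number
is a multiple of `3`: `g_p · (e_p f_p) = 9` (fundamental identity for the Galois extension `F₃/ℚ`,
Neukirch I (8.2), (9.1)) with `e_p f_p ∣ 3`.
[cite: DokchitserDokchitser2011RankModN, proof of Thm. 2] [cite: NeukirchANT1999, Ch. I (8.2)] -/
theorem three_dvd_card_placesOver (v : HeightOneSpectrum (𝓞 ℚ)) :
    3 ∣ Nat.card {w : HeightOneSpectrum (𝓞 F₃) // w.under (𝓞 ℚ) = v} := by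
  haveI : NeZero v.asIdeal := ⟨v.ne_bot⟩
  haveI := v.isPrime
  haveI : Fact (absNorm (v.asIdeal.under ℤ)).Prime := ⟨Nat.absNorm_under_prime v.asIdeal⟩
  rw [card_placesOver_eq_ncard_primesOver]
  have hfi := ncard_primesOver_mul_ramificationIdxIn_mul_inertiaDegIn
    (span {((absNorm (v.asIdeal.under ℤ) : ℕ) : ℤ)}) (𝓞 F₃) Gal(F₃/ℚ)
  rw [card_aut] at hfi
  rcases (Nat.dvd_prime Nat.prime_three).mp
      (ramificationIdxIn_mul_inertiaDegIn_dvd_three (absNorm (v.asIdeal.under ℤ))) with h | h <;>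
    rw [h] at hfi <;> omega

/-- **`F₃` is totally real with `9` infinite places**: `F₃/ℚ` is Galois of odd degree `9`, hence
unramified at infinity (Mathlib `IsUnramifiedAtInfinitePlaces_of_odd_finrank`), so
`#(infinite places) = #(infinite places of ℚ) · [F₃ : ℚ] = 9`.
[cite: DokchitserDokchitser2011RankModN, proof of Thm. 2] -/
theorem card_infinitePlace : Fintype.card (InfinitePlace F₃) = 9 := by
  haveI := IsUnramifiedAtInfinitePlaces_of_odd_finrank (k := ℚ) (K := F₃)
    (by rw [finrank_eq]; decide)
  rw [IsUnramifiedAtInfinitePlaces.card_infinitePlace ℚ F₃, finrank_eq, Fintype.card_unique, one_mul]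

/-- The infinite place of `ℚ` has `9` places of `F₃` above it, a multiple of `3`.
[cite: DokchitserDokchitser2011RankModN, proof of Thm. 2] -/
theorem three_dvd_card_infinitePlacesOver (v : InfinitePlace ℚ) :
    3 ∣ Nat.card {w : InfinitePlace F₃ // w.comap (algebraMap ℚ F₃) = v} := by
  have h : Nat.card {w : InfinitePlace F₃ // w.comap (algebraMap ℚ F₃) = v} = 9 := by
    rw [Nat.card_congr (Equiv.subtypeUnivEquiv fun w => Subsingleton.elim _ _),
      Nat.card_eq_fintype_card, card_infinitePlace]
  rw [h]
  norm_num

end F₃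

end DokchitserDokchitser2011

open DokchitserDokchitser2011

/-! ### The `n = 3` case of Theorem 2 from `rk E(F₃) = 1` -/

/-- **The `n = 3` witness of Theorem 2, from the descent computation alone**: the named fact
`DokchitserDokchitser2011_rank_480a1_F3` (some degree-`9` Galois number field inside `ℚ(ζ₁₃₃₉)`
with a multiple of `3` places above every place of `ℚ` has `rk E(F) = 1` for `E = 480a1`) holds
with `F = F₃`, all of whose field-theoretic clauses are theorems of this file
(`F₃.instIsGalois`, `F₃.finrank_eq`, `F₃.toCyclotomicField`, `F₃.three_dvd_card_placesOver`,
`F₃.three_dvd_card_infinitePlacesOver`), granted `rk_ℤ E(F₃) = 1`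
(`WeierstrassCurve.mordellWeilRank`, i.e. `finrank ℤ E(F₃)`) — in the source "2-descent shows that
`rk E/F₃ = 1` (e.g. using Magma, over all minimal non-trivial subfields of `F_n`)", a computer
`2`-descent over the four cubic subfields of `F₃` that is not formalised and enters as the
hypothesis `h`. [cite: DokchitserDokchitser2011RankModN, proof of Thm. 2] -/
theorem DokchitserDokchitser2011_rank_480a1_F3_of_descent
    (h : (curve480a1.baseChange F₃).mordellWeilRank = 1) : DokchitserDokchitser2011_rank_480a1_F3 :=
  ⟨F₃, inferInstance, inferInstance, F₃.instIsGalois, F₃.finrank_eq, ⟨F₃.toCyclotomicField⟩,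
    F₃.three_dvd_card_placesOver, F₃.three_dvd_card_infinitePlacesOver, h⟩

open scoped Classical in
/-- **Isomorphic fields have isomorphic Mordell–Weil groups**: a `ℚ`-algebra isomorphism
`e : F ≃ₐ[ℚ] K` induces `E(F) ≃+ E(K)` for every `E/ℚ` (transport of coordinates, Mathlib
`WeierstrassCurve.Affine.Point.map`, functorial: `map_map`). The group laws are Mathlib's,
elaborated against the classical `DecidableEq` instances, as in `WeierstrassCurve.mordellWeilRank`.
[folklore] -/
def pointEquivOfAlgEquiv (W : WeierstrassCurve ℚ) {F K : Type} [Field F] [Field K] [Algebra ℚ F]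
    [Algebra ℚ K] (e : F ≃ₐ[ℚ] K) :
    (W.baseChange F).toAffine.Point ≃+ (W.baseChange K).toAffine.Point :=
  { Affine.Point.map (W' := W.toAffine) (e : F →ₐ[ℚ] K) with
    invFun := Affine.Point.map (W' := W.toAffine) (e.symm : K →ₐ[ℚ] F)
    left_inv := fun P => by
      change Affine.Point.map (W' := W.toAffine) (e.symm : K →ₐ[ℚ] F)
        (Affine.Point.map (W' := W.toAffine) (e : F →ₐ[ℚ] K) P) = P
      rw [Affine.Point.map_map, AlgEquiv.symm_comp]
      cases P <;> rfl
    right_inv := fun P => by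
      change Affine.Point.map (W' := W.toAffine) (e : F →ₐ[ℚ] K)
        (Affine.Point.map (W' := W.toAffine) (e.symm : K →ₐ[ℚ] F) P) = P
      rw [Affine.Point.map_map, AlgEquiv.comp_symm]
      cases P <;> rfl }

open scoped Classical in
/-- `rank_ℤ E(F) = rank_ℤ E(K)` for `ℚ`-isomorphic fields `F ≃ₐ[ℚ] K` (`pointEquivOfAlgEquiv` is
`ℤ`-linear). [folklore] -/
theorem mordellWeilRank_baseChange_eq_of_algEquiv (W : WeierstrassCurve ℚ) {F K : Type} [Field F]
    [Field K] [Algebra ℚ F] [Algebra ℚ K] (e : F ≃ₐ[ℚ] K) :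
    (W.baseChange F).mordellWeilRank = (W.baseChange K).mordellWeilRank :=
  (pointEquivOfAlgEquiv W e).toIntLinearEquiv.finrank_eq

/-- **The parent fact is equivalent to `rk E(F₃) = 1`**: a number field `F` of degree `9` with a
`ℚ`-embedding `F → ℚ(ζ₁₃₃₉)` has image THE degree-`9` subfield `F₃` (`F₃.eq_of_finrank_eq`), so
`F ≃ₐ[ℚ] F₃` and `rank_ℤ E(F) = rank_ℤ E(F₃)` (`mordellWeilRank_baseChange_eq_of_algEquiv`); the
converse is `DokchitserDokchitser2011_rank_480a1_F3_of_descent`. Hence the existential named fact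
`DokchitserDokchitser2011_rank_480a1_F3` says exactly "`rk_ℤ 480a1(F₃) = 1`" for the field `F₃`
constructed here, and nothing is lost by not naming that equation separately.
[cite: DokchitserDokchitser2011RankModN, proof of Thm. 2] -/
theorem DokchitserDokchitser2011_rank_480a1_F3_iff_descent :
    DokchitserDokchitser2011_rank_480a1_F3 ↔ (curve480a1.baseChange F₃).mordellWeilRank = 1 := by
  refine ⟨fun ⟨F, _, _, _, h9, ⟨f⟩, _, _, hr⟩ => ?_,
    DokchitserDokchitser2011_rank_480a1_F3_of_descent⟩
  let g : F →ₐ[ℚ] Cyclotomic1339 := Cyclotomic1339.ofCyclotomicField.comp f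
  have hK : g.fieldRange = F₃ := F₃.eq_of_finrank_eq g.fieldRange
    (by rw [← h9]; exact (g.equivFieldRange.toLinearEquiv.finrank_eq).symm)
  rw [← hr]
  exact (mordellWeilRank_baseChange_eq_of_algEquiv curve480a1
    (g.equivFieldRange.trans (IntermediateField.equivOfEq hK))).symm

/-- **The Mordell–Weil rank modulo `3` is not a sum of local invariants, from the descent computation
alone** (the `n = 3` case of Theorem 2 of Dokchitser–Dokchitser 2011): by Lemma 3
(`not_isSumOfLocalInvariants_rankInvariant_of_witness`) a `ℤ/3ℤ`-valued local formula for the rank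
would give `rk E(F₃) ≡ 0 (mod 3)`, but `rk E(F₃) = 1` (the hypothesis `h`, "2-descent shows that
`rk E/F₃ = 1`", not formalised). [cite: DokchitserDokchitser2011RankModN, Thm. 2 (proof)] -/
theorem not_isSumOfLocalInvariants_rankInvariant_zmod_three_of_descent
    (h : (curve480a1.baseChange F₃).mordellWeilRank = 1) :
    ¬ IsSumOfLocalInvariants (rankInvariant (ZMod 3)) :=
  not_isSumOfLocalInvariants_rankInvariant_of_witness 3 F₃ curve480a1 F₃.three_dvd_card_placesOver
    F₃.three_dvd_card_infinitePlacesOver (by rw [h]; decide)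

end Literature.Barriers.BirchSwinnertonDyer

end
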